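import Summits.QuantumFields.YangMills.Theorems.UnitScaleTiltProp7ConjFrameTransport
import Literature.MathematicalPhysics.QuantumFieldTheory.Balaban1983to89.B9Eq335RegularityClasses
import Literature.Analysis.Complex.RungeUnits
import HarnessLib

/-!
# Route `UnitScaleTilt`, crux K1 «MinimiserStabilityRegPr» (stmt-QuantumFields-19200), route-R E′ path (α′), LEMMA-H-curved, design (x2′-corner) — THE (3.35) DICTIONARY:
# a [Balaban1985BackgroundPropagators] (3.35) cube gauge IS a frame whose holonomies are `e^{iηA}` with `|A| < Cξ⁻¹`, `|∇A| < Cξ⁻²`, hence the frame rows of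
# ✓ `UnitScaleTiltProp7ConjFrameTransport` hold with `τ₁ = ηCξ⁻¹·e^{ηCξ⁻¹}` (size) and `τ₂ = η²Cξ⁻²·e^{ηCξ⁻¹}` (backward difference) — ONE PLAQUETTE

Cell `ym3-torus`, extra width seat `ym-routeR-w4` (g9); this seat's LOCATE 2 (bus 2026-08-28 18:41Z) made kernel-checkable.  THEOREMS ONLY (0 `def`, 0 `sorry`) on the abstract
carrier of `B9Eq39Adjoint` (sites `S`, directions `ι`, shifts `T`, background `U : ι → S → 𝔸ˣ`); the (3.35) class is r06's ✓`B9Eq335RegularityClasses.Reg335Cube T U η cube ξ C`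
(gauge `u` of unitary type on the cube with `gaugeTr T u U = fluct η A`, `‖A κ z‖ < Cξ⁻¹`, `‖η⁻¹D¹_κA_ν(z)‖ < Cξ⁻²` on the cube), the frame is `P := u⁻¹` (inline), and the frame
holonomy of ✓`Prop7ConjFrameTransport` is then LITERALLY `gaugeTr T u U μ x = e^{iηA_μ(x)}`.  `--supports stmt-QuantumFields-19200`, count-neutral.  YM₃ on T³ is a ladder
rung (R3), not the Clay problem; nothing here claims LEMMA-H-curved, a stub, the crux or the gap.

WHAT IS PROVED (ns `…Theorems.Prop7ConjFrameReg335`).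
* §1 (any ring) `frameHol_eq_gaugeTr` — with `P z := (u z)⁻¹`: `(P x)⁻¹·U μ x·P (T μ x) = gaugeTr T u U μ x`; `flatCovD_eq_sub` (`D¹_κ f (z) = f(z + e_κ) − f(z)` at the
  trivial background).
* §2 (complete normed `ℂ`-algebra with `‖1‖ = 1`) `val_fluct` (`↑(fluct η A μ x) = exp((iη)•A_μ(x))`); ★ `norm_fluct_sub_one_le` (`‖e^{iηA} − 1‖ ≤ η‖A‖·e^{η‖A‖}`);
  ★ `norm_fluct_sub_fluct_le` (`‖e^{iηA(x)} − e^{iηA(y)}‖ ≤ η‖A(x) − A(y)‖·e^{η·max}`) — ✓`Literature.Analysis.Complex.norm_exp_sub_exp_le` by name.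
* §3 ★★ `frame_rows_of_reg335Cube` — from `Reg335Cube T U η cube ξ C` (`0 < η`): a gauge `u` (bi-contractive on the cube) such that for every bond `(x, μ)` with
  `x, x + e_μ` … read on the cube: SIZE `‖h_μ(x) − 1‖ ≤ (ηCξ⁻¹)·e^{ηCξ⁻¹}` and, for `x − e_μ` also in the cube, DIFFERENCE `‖h_μ(x) − h_μ(x − e_μ)‖ ≤ (η²C(ξ²)⁻¹)·e^{ηCξ⁻¹}`,
  `h_μ(x) := gaugeTr T u U μ x` — the two inputs `τ₁, τ₂` of ✓`Prop7ConjFrameTransport.norm_covDstar_covD_conjFrame_le_pair` (second-order site row `≤ 2(τ₂ + 2τ₁²)‖m̊‖` =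
  ONE PLAQUETTE at scale `ξ`, k-uniform) and of ✓`Prop7ConjFrameTransition.norm_transition_foldl_sub_le`.
HONEST SCOPE.  A dictionary over tree letters ([folklore] algebra + the exponential Lipschitz bound); (3.35) itself is a HYPOTHESIS class here — where the knit gets it for the
door's background ([B8] Thm 2 (1.33) second clause ∕ [Balaban1985Variational] p.280 «(3.35) … is satisfied for U₀ … because of the result of Sect. F») is the knit's business.

References: T. Bałaban, CMP 99 (1985) 389–434 [Balaban1985BackgroundPropagators] ((3.28) p.395, (3.35) p.396); CMP 99 (1985) 75–102 [Balaban1985RegularSpaces] ((1.33) p.82);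
CMP 102 (1985) 277–309 [Balaban1985Variational] (Sect. A p.280).
-/

noncomputable section

namespace Summit.QuantumFields.YangMills.Theorems.Prop7ConjFrameReg335

open Literature.MathematicalPhysics.QuantumFieldTheory.Balaban1983to89
open B9Eq39Adjoint (R covD fluct)
open B9Eq3117Current (gaugeTr)
open B9Eq335RegularityClasses (Reg335Cube)

/-! ## §1 The frame of a cube gauge (any ring) -/

section RingLevel

variable {𝔸 : Type*} [Ring 𝔸] {S : Type*} {ι : Type*} (T : ι → Equiv.Perm S) (U : ι → S → 𝔸ˣ)

/-- With the frame `P z := (u z)⁻¹` the frame holonomy of ✓`Prop7ConjFrameTransport` is the gauge-transformed bond variable (3.28): `(P x)⁻¹·U_μ(x)·P(x+e_μ) = (U^u)_μ(x)`.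
[cite: Balaban1985BackgroundPropagators, (3.28) p.395] -/
theorem frameHol_eq_gaugeTr (u : S → 𝔸ˣ) (μ : ι) (x : S) :
    ((fun z => (u z)⁻¹) x)⁻¹ * U μ x * (fun z => (u z)⁻¹) (T μ x) = gaugeTr T u U μ x := by
  simp only [inv_inv, gaugeTr]

omit U in
/-- The flat covariant derivative is the forward difference: `D¹_κ f(z) = f(z + e_κ) − f(z)`. [cite: Balaban1985BackgroundPropagators, (3.3) p.390] -/
theorem flatCovD_eq_sub (κ : ι) (f : S → 𝔸) (z : S) :
    covD T (fun (_ : ι) (_ : S) => (1 : 𝔸ˣ)) κ f z = f (T κ z) - f z := by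
  simp [covD, B9Eq39Adjoint.R_one]

end RingLevel

/-! ## §2 `e^{iηA}`: value, size, Lipschitz -/

section ExpLevel

variable {𝔸 : Type} [NormedRing 𝔸] [NormedAlgebra ℂ 𝔸] [CompleteSpace 𝔸] [NormOneClass 𝔸] {S : Type*} {ι : Type*}

omit [NormOneClass 𝔸] in
/-- `↑(fluct η A μ x) = exp((iη)•A_μ(x))`. [cite: Balaban1985BackgroundPropagators, (3.37) p.396, bookkeeping] -/
theorem val_fluct (η : ℝ) (A : ι → S → 𝔸) (μ : ι) (x : S) :
    ((fluct η A μ x : 𝔸ˣ) : 𝔸) = NormedSpace.exp (((Complex.I * η : ℂ)) • A μ x) := by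
  simp [fluct, Beta.TransportVertices.holonomy]

omit [CompleteSpace 𝔸] [NormOneClass 𝔸] in
/-- `‖(iη)•X‖ = η‖X‖` for `η ≥ 0`. [folklore] -/
theorem norm_Ieta_smul {η : ℝ} (hη : 0 ≤ η) (X : 𝔸) : ‖((Complex.I * η : ℂ)) • X‖ = η * ‖X‖ := by
  rw [norm_smul, norm_mul, Complex.norm_I, one_mul, Complex.norm_real, Real.norm_of_nonneg hη]

/-- ★ SIZE: `‖e^{iηA} − 1‖ ≤ η‖A‖·e^{η‖A‖}`. [cite: Balaban1985BackgroundPropagators, (3.35) p.396, bookkeeping] -/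
theorem norm_fluct_sub_one_le {η : ℝ} (hη : 0 ≤ η) (A : ι → S → 𝔸) (μ : ι) (x : S) :
    ‖((fluct η A μ x : 𝔸ˣ) : 𝔸) - 1‖ ≤ η * ‖A μ x‖ * Real.exp (η * ‖A μ x‖) := by
  rw [val_fluct]
  have h := Literature.Analysis.Complex.norm_exp_sub_exp_le (((Complex.I * η : ℂ)) • A μ x) (0 : 𝔸)
  rw [NormedSpace.exp_zero, sub_zero, norm_zero, norm_Ieta_smul hη] at h
  rwa [max_eq_left (mul_nonneg hη (norm_nonneg _))] at h

/-- ★ LIPSCHITZ: `‖e^{iηA(x)} − e^{iηA(y)}‖ ≤ η‖A(x) − A(y)‖·e^{η·max(‖A(x)‖, ‖A(y)‖)}`. [cite: Balaban1985BackgroundPropagators, (3.35) p.396, bookkeeping] -/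
theorem norm_fluct_sub_fluct_le {η : ℝ} (hη : 0 ≤ η) (A : ι → S → 𝔸) (μ : ι) (x y : S) :
    ‖((fluct η A μ x : 𝔸ˣ) : 𝔸) - ((fluct η A μ y : 𝔸ˣ) : 𝔸)‖
      ≤ η * ‖A μ x - A μ y‖ * Real.exp (η * max ‖A μ x‖ ‖A μ y‖) := by
  rw [val_fluct, val_fluct]
  have h := Literature.Analysis.Complex.norm_exp_sub_exp_le (((Complex.I * η : ℂ)) • A μ x) (((Complex.I * η : ℂ)) • A μ y)
  rw [← smul_sub, norm_Ieta_smul hη, norm_Ieta_smul hη, norm_Ieta_smul hη] at h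
  rwa [← mul_max_of_nonneg _ _ hη] at h

end ExpLevel

/-! ## §3 The frame rows of a (3.35) cube gauge -/

section Reg335Level

variable {𝔸 : Type} [NormedRing 𝔸] [NormedAlgebra ℂ 𝔸] [CompleteSpace 𝔸] [NormOneClass 𝔸] {S : Type*} {ι : Type*}
  (T : ι → Equiv.Perm S) (U : ι → S → 𝔸ˣ)

/-- ★★ **THE (3.35) DICTIONARY**: a (3.35) cube gauge `u` (scale `ξ`, constant `C`, spacing `η ≥ 0`) is a frame whose holonomies `h_μ(x) = (U^u)_μ(x) = e^{iηA_μ(x)}` satisfy, on the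
cube, SIZE `‖h_μ(x) − 1‖ ≤ (η·(Cξ⁻¹))·e^{η·(Cξ⁻¹)}` and, whenever `x − e_μ` is also in the cube, BACKWARD DIFFERENCE `‖h_μ(x) − h_μ(x − e_μ)‖ ≤ (η·(η·(C(ξ²)⁻¹)))·e^{η·(Cξ⁻¹)}` — the
inputs `τ₁, τ₂` of ✓`Prop7ConjFrameTransport.norm_covDstar_covD_conjFrame_le_pair` (⇒ second-order site row `≤ 2(τ₂ + 2τ₁²)‖m̊‖`, one plaquette at scale `ξ`).
[cite: Balaban1985BackgroundPropagators, (3.35) p.396, (3.28) p.395] -/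
theorem frame_rows_of_reg335Cube {η : ℝ} (hη : 0 < η) {cube : Set S} {ξ C : ℝ} (h : Reg335Cube T U η cube ξ C) :
    ∃ u : S → 𝔸ˣ, (∀ z ∈ cube, ‖(u z : 𝔸)‖ ≤ 1 ∧ ‖(((u z)⁻¹ : 𝔸ˣ) : 𝔸)‖ ≤ 1) ∧
      (∀ (μ : ι), ∀ x ∈ cube, ‖((gaugeTr T u U μ x : 𝔸ˣ) : 𝔸) - 1‖ ≤ η * (C * ξ⁻¹) * Real.exp (η * (C * ξ⁻¹))) ∧
      (∀ (μ : ι), ∀ x ∈ cube, (T μ).symm x ∈ cube →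
        ‖((gaugeTr T u U μ x : 𝔸ˣ) : 𝔸) - ((gaugeTr T u U μ ((T μ).symm x) : 𝔸ˣ) : 𝔸)‖
          ≤ η * (η * (C * (ξ ^ 2)⁻¹)) * Real.exp (η * (C * ξ⁻¹))) := by
  obtain ⟨u, A, hu, hg, hA, hD⟩ := h
  refine ⟨u, hu, fun μ x hx => ?_, fun μ x hx hy => ?_⟩
  · rw [hg μ x hx]
    have hAx : ‖A μ x‖ ≤ C * ξ⁻¹ := (hA μ x hx).le
    have hCξ : 0 ≤ C * ξ⁻¹ := (norm_nonneg _).trans hAx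
    calc _ ≤ η * ‖A μ x‖ * Real.exp (η * ‖A μ x‖) := norm_fluct_sub_one_le hη.le A μ x
      _ ≤ η * (C * ξ⁻¹) * Real.exp (η * (C * ξ⁻¹)) :=
          mul_le_mul (mul_le_mul_of_nonneg_left hAx hη.le) (Real.exp_le_exp.2 (mul_le_mul_of_nonneg_left hAx hη.le))
            (Real.exp_pos _).le (mul_nonneg hη.le hCξ)
  · set y := (T μ).symm x with hy'
    have hTy : T μ y = x := Equiv.apply_symm_apply _ _
    rw [hg μ x hx, hg μ y hy]
    have hAx : ‖A μ x‖ ≤ C * ξ⁻¹ := (hA μ x hx).le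
    have hAy : ‖A μ y‖ ≤ C * ξ⁻¹ := (hA μ y hy).le
    -- the flat-gradient clause at `(y, μ, μ)`: `‖η⁻¹ • (A μ (T μ y) − A μ y)‖ < C (ξ²)⁻¹`
    have hdiff : ‖A μ x - A μ y‖ ≤ η * (C * (ξ ^ 2)⁻¹) := by
      have h1 := hD μ μ y hy
      rw [flatCovD_eq_sub, hTy, norm_smul, norm_inv, Complex.norm_real, Real.norm_of_nonneg hη.le] at h1
      exact ((inv_mul_lt_iff₀ hη).1 h1).le
    have hd0 : 0 ≤ η * (C * (ξ ^ 2)⁻¹) := (norm_nonneg _).trans hdiff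
    calc _ ≤ η * ‖A μ x - A μ y‖ * Real.exp (η * max ‖A μ x‖ ‖A μ y‖) := norm_fluct_sub_fluct_le hη.le A μ x y
      _ ≤ η * (η * (C * (ξ ^ 2)⁻¹)) * Real.exp (η * (C * ξ⁻¹)) :=
          mul_le_mul (mul_le_mul_of_nonneg_left hdiff hη.le) (Real.exp_le_exp.2 (mul_le_mul_of_nonneg_left (max_le hAx hAy) hη.le))
            (Real.exp_pos _).le (mul_nonneg hη.le hd0)

end Reg335Level

/-! ## §4 (APPEND v1.1) Re-basing at the centre: frames normalised to `1` at a chosen site (★routeR-w1 g5's `Fr y (embIter k y) = 1`)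

A (3.35) gauge `u` can be re-based by the CONSTANT unit `u(c)`: the frame `P z := (u z)⁻¹·u(c)` has `P c = 1`, is bi-contractive on the cube, and its holonomies are the
constant conjugates `h′_μ(x) = u(c)⁻¹·(U^u)_μ(x)·u(c)` of the gauge-transformed bond variables — so the SIZE and DIFFERENCE rows of §3 hold for `h′` with the SAME `τ₁, τ₂`
(conjugation by a bi-contractive unit does not increase `‖· − ·‖`, in particular `‖· − 1‖`). -/

section Rebase

variable {𝔸 : Type*} [Ring 𝔸] {S : Type*} {ι : Type*} (T : ι → Equiv.Perm S) (U : ι → S → 𝔸ˣ)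

/-- The re-based frame's holonomy is the constant conjugate of the gauge-transformed bond: `(P x)⁻¹·U_μ(x)·P(x+e_μ) = u(c)⁻¹·(U^u)_μ(x)·u(c)` for `P z := (u z)⁻¹·u(c)`.
[cite: Balaban1985BackgroundPropagators, (3.28) p.395] -/
theorem rebasedFrameHol_eq (u : S → 𝔸ˣ) (c : S) (μ : ι) (x : S) :
    ((fun z => (u z)⁻¹ * u c) x)⁻¹ * U μ x * (fun z => (u z)⁻¹ * u c) (T μ x) = (u c)⁻¹ * gaugeTr T u U μ x * u c := by
  simp only [gaugeTr, mul_inv_rev, inv_inv, mul_assoc]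

omit T U in
/-- The re-based frame is `1` at the base site. [folklore] -/
theorem rebasedFrame_base (u : S → 𝔸ˣ) (c : S) : (fun z => (u z)⁻¹ * u c) c = 1 := by
  simp

end Rebase

section RebaseNorm

variable {𝔸 : Type} [NormedRing 𝔸] [NormedAlgebra ℂ 𝔸] [CompleteSpace 𝔸] [NormOneClass 𝔸] {S : Type*} {ι : Type*}
  (T : ι → Equiv.Perm S) (U : ι → S → 𝔸ˣ)

omit [NormedAlgebra ℂ 𝔸] [CompleteSpace 𝔸] [NormOneClass 𝔸] T U in
/-- Conjugation by a bi-contractive unit does not increase distances: `‖v⁻¹hv − v⁻¹h′v‖ ≤ ‖h − h′‖` (with `h′ = 1`: nor the distance to `1` — the tree's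
✓`B9Eq335PlaquetteAtLettersY.norm_conj_sub_one_le`, not re-stated here). [folklore] -/
theorem norm_conj_sub_conj_le {v : 𝔸ˣ} (hv : ‖(v : 𝔸)‖ ≤ 1 ∧ ‖((v⁻¹ : 𝔸ˣ) : 𝔸)‖ ≤ 1) (h h' : 𝔸ˣ) :
    ‖((v⁻¹ * h * v : 𝔸ˣ) : 𝔸) - ((v⁻¹ * h' * v : 𝔸ˣ) : 𝔸)‖ ≤ ‖(h : 𝔸) - h'‖ := by
  have e : ((v⁻¹ * h * v : 𝔸ˣ) : 𝔸) - ((v⁻¹ * h' * v : 𝔸ˣ) : 𝔸) = ((v⁻¹ : 𝔸ˣ) : 𝔸) * ((h : 𝔸) - h') * (v : 𝔸) := by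
    simp only [Units.val_mul, mul_sub, sub_mul]
  rw [e]
  calc _ ≤ ‖((v⁻¹ : 𝔸ˣ) : 𝔸) * ((h : 𝔸) - h')‖ * ‖(v : 𝔸)‖ := norm_mul_le _ _
    _ ≤ (‖((v⁻¹ : 𝔸ˣ) : 𝔸)‖ * ‖(h : 𝔸) - h'‖) * 1 := by gcongr; exacts [norm_mul_le _ _, hv.1]
    _ ≤ (1 * ‖(h : 𝔸) - h'‖) * 1 := by gcongr; exact hv.2
    _ = ‖(h : 𝔸) - h'‖ := by ring

/-- ★★ **THE (3.35) DICTIONARY, RE-BASED AT A CENTRE**: from `Reg335Cube T U η cube ξ C` (`0 < η`) a gauge `u` (bi-contractive on the cube) such that for EVERY base site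
`c` of the cube the frame `P_c z := (u z)⁻¹·u(c)` satisfies: `P_c c = 1`; `P_c` bi-contractive on the cube; and, written in ✓`Prop7ConjFrameTransport`'s inline holonomy
`h_μ(x) = (P_c x)⁻¹·U_μ(x)·P_c(x + e_μ)`, SIZE `‖h_μ(x) − 1‖ ≤ η(Cξ⁻¹)e^{η(Cξ⁻¹)}` on the cube and BACKWARD DIFFERENCE `‖h_μ(x) − h_μ(x − e_μ)‖ ≤ η(η(C(ξ²)⁻¹))e^{η(Cξ⁻¹)}` whenever
`x, x − e_μ` are in the cube — ★routeR-w1 g5's F-H5a rows `(hA)` with `Fr y := P_{embIter k y}` on the `4ℓ`-cube around the centre. [cite: Balaban1985BackgroundPropagators, (3.35) p.396, (3.28) p.395] -/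
theorem frame_rows_of_reg335Cube_rebased {η : ℝ} (hη : 0 < η) {cube : Set S} {ξ C : ℝ} (h : Reg335Cube T U η cube ξ C) :
    ∃ u : S → 𝔸ˣ, (∀ z ∈ cube, ‖(u z : 𝔸)‖ ≤ 1 ∧ ‖(((u z)⁻¹ : 𝔸ˣ) : 𝔸)‖ ≤ 1) ∧
      ∀ c ∈ cube,
        (fun z => (u z)⁻¹ * u c) c = 1 ∧
        (∀ z ∈ cube, ‖(((fun z => (u z)⁻¹ * u c) z : 𝔸ˣ) : 𝔸)‖ ≤ 1 ∧ ‖((((fun z => (u z)⁻¹ * u c) z)⁻¹ : 𝔸ˣ) : 𝔸)‖ ≤ 1) ∧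
        (∀ (μ : ι), ∀ x ∈ cube,
          ‖((((fun z => (u z)⁻¹ * u c) x)⁻¹ * U μ x * (fun z => (u z)⁻¹ * u c) (T μ x) : 𝔸ˣ) : 𝔸) - 1‖
            ≤ η * (C * ξ⁻¹) * Real.exp (η * (C * ξ⁻¹))) ∧
        (∀ (μ : ι), ∀ x ∈ cube, (T μ).symm x ∈ cube →
          ‖((((fun z => (u z)⁻¹ * u c) x)⁻¹ * U μ x * (fun z => (u z)⁻¹ * u c) (T μ x) : 𝔸ˣ) : 𝔸)
              - ((((fun z => (u z)⁻¹ * u c) ((T μ).symm x))⁻¹ * U μ ((T μ).symm x) * (fun z => (u z)⁻¹ * u c) (T μ ((T μ).symm x)) : 𝔸ˣ) : 𝔸)‖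
            ≤ η * (η * (C * (ξ ^ 2)⁻¹)) * Real.exp (η * (C * ξ⁻¹))) := by
  obtain ⟨u, hu, hsize, hdiff⟩ := frame_rows_of_reg335Cube T U hη h
  refine ⟨u, hu, fun c hc => ⟨rebasedFrame_base u c, fun z hz => ?_, fun μ x hx => ?_, fun μ x hx hy => ?_⟩⟩
  · exact B9Thm310CommutatorDataOfPlaquettes.bicontr_mul (B9Thm310CommutatorDataOfPlaquettes.bicontr_inv (hu z hz)) (hu c hc)
  · rw [rebasedFrameHol_eq]
    have e1 : ((u c)⁻¹ * 1 * u c : 𝔸ˣ) = 1 := by group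
    have h1 := norm_conj_sub_conj_le (hu c hc) (gaugeTr T u U μ x) 1
    rw [e1, Units.val_one] at h1
    exact h1.trans (hsize μ x hx)
  · rw [rebasedFrameHol_eq, rebasedFrameHol_eq]
    exact (norm_conj_sub_conj_le (hu c hc) _ _).trans (hdiff μ x hx hy)

end RebaseNorm

end Summit.QuantumFields.YangMills.Theorems.Prop7ConjFrameReg335

end
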